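import Summits.RiemannHypothesis.RiemannHypothesis.Theorems.TiltedLandingLaw421R3PurseP

/-! # law421 PURSE `half` — re-cut candidate (C4 «kernel desk» rh-idea-6 g29; SUPPORT module, fully proved). Depth `4 * hmax / s + (Hs / s) ^ 2 + B + 1 + ((B : ℝ) + 1) / 2`.
`halfPurse`, `law421Half_iff_text` (`Iff.rfl` vs the sig text), `restRateBotHalf_iff_text`, `law421Half_of_succ_rate`. RH is NOT proved. -/

namespace RhW08.PurseP

open Complex
open RhIdea6.G17.W07C7 RhIdea6.G17.W07C7.Rev6 RhIdea6.G18.W07C8.Law421BirthS RhIdea6.G19.W07C11.Seam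
open RhIdea6.G20.W07C12.Frac RhIdea6.G20.W07C12.StColP RhW07.C12.FieldSplit RhIdea6.G21.W07C13.TentMax
open RhW07.C14.TwoSided RhW07.C14.Classes RhW07.C14.Lineage RhW07.C14.Booking
open RhW07.C13.Heredity RhIdea6.G22.W07C15pre.Injection RhW07.E3.Cell
open RhW07.E3.Lit
open RhW08.Round1 RhW08.StSwap RhW08.Round2 RhW08.QuadW
open RhW08.SealSwap (PBot)
open RhW08.SealSwapQ
open Summit.RiemannHypothesis.RiemannHypothesis.Theorems.Splittings.EarlyAppointmentsLocalFourierPolya (exists_nonLaguerre_critical_of_boundary_sign)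

/-- the `half` purse. -/
noncomputable def halfPurse : Purse := fun _ _ s hmax _ Hs B => 4 * hmax / s + (Hs / s) ^ 2 + B + 1 + ((B : ℝ) + 1) / 2

/-- (K) the sig text IS `Law421P halfPurse` (definitional). -/
theorem law421Half_iff_text : Law421P halfPurse ↔
    (∀ (η : ℝ) (f : ℂ → ℂ) (x₀ s hmax R Hs : ℝ) (B : ℕ), Differentiable ℂ f → (∀ x : ℝ, (f (x : ℂ)).im = 0) → (∃ A' B' ρ : ℝ, ρ < 2 ∧ ∀ z : ℂ, ‖f z‖ ≤ A' * Real.exp (B' * ‖z‖ ^ ρ)) → 0 < s → 2 * s ≤ hmax → 2 * hmax ≤ R → 3 * hmax < R → 0 ≤ Hs → (∀ w : ℂ, f w = 0 → |w.im| ≤ Hs) → 2 * Hs ≤ R → (∃ w₀ : ℂ, f w₀ = 0 ∧ w₀.im ≠ 0 ∧ w₀.re = x₀ ∧ |w₀.im| ≤ hmax) → (∀ r : ℝ, s ≤ r → r ≤ R → (∑ᶠ u ∈ {u : ℂ | f u = 0 ∧ |u.re - x₀| ≤ r}, ((analyticOrderAt f u).toNat : ℝ)) - 2 * r / s ≤ B)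 → (∀ r : ℝ, s ≤ r → r ≤ R → |(∑ᶠ u ∈ {u : ℂ | f u = 0 ∧ x₀ < u.re ∧ u.re ≤ x₀ + r}, ((analyticOrderAt f u).toNat : ℝ)) - r / s| ≤ 1 + B ∧ |(∑ᶠ u ∈ {u : ℂ | f u = 0 ∧ x₀ - r ≤ u.re ∧ u.re < x₀}, ((analyticOrderAt f u).toNat : ℝ)) - r / s| ≤ 1 + B) → 0 ≤ η → 2 * η ≤ 1 → (∀ w : ℂ, |w.re - x₀| ≤ R / 2 → |w.im| ≤ hmax → f w ≠ 0 → ‖deriv f w / f w - ∑ᶠ u ∈ {u : ℂ | f u = 0 ∧ |u.re - w.re| < R / 2}, ((analyticOrderAt f u).toNat : ℂ) * (w - u)⁻¹‖ ≤ η / s) → ∃ k : ℕ, (k : ℝ) ≤ 4 * hmax / s + (Hs / s) ^ 2 + B + 1 + ((B : ℝ) + 1) / 2 ∧ ∃ x : ℝ, |x - x₀| < ((k : ℝ) + 3) * R / 2 ∧ ((iteratedDeriv (k + 1) f (x : ℂ)).re = 0 ∧ (iteratedDeriv k f (x : ℂ)).re ≠ 0 ∧ 0 ≤ (iteratedDeriv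 k f (x : ℂ)).re * (iteratedDeriv (k + 2) f (x : ℂ)).re)) :=
  Iff.rfl

open Classical in
/-- (K) the RATE stub at `halfPurse`, spelled. -/
theorem restRateBotHalf_iff_text : RestRateBotPQ halfPurse ↔
    (∀ (η : ℝ) (f : ℂ → ℂ) (x₀ s hmax R Hs : ℝ) (B : ℕ), EngineHyps5 2 η f x₀ s hmax R Hs B →
    ∀ k : ℕ, chargeCount (PTrkSQ PBot) StTrkDQ ReadyR2 η f x₀ s hmax R Hs B k
        + max (tentMeterTrkD (3 / 2) η f x₀ s hmax R Hs B 0 - injected (PTrkSQ PBot) StTrkDQ ReadyR2 EmptyTrkDQ η f x₀ s hmax R Hs B k) 0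
        + 4 * lowH StTrkDQ η f x₀ s hmax R Hs B k / s
        + (∑ j ∈ Finset.range k, (if Charged (PTrkSQ PBot) StTrkDQ ReadyR2 η f x₀ s hmax R Hs B j then 0 else
            4 * (lowH StTrkDQ η f x₀ s hmax R Hs B j - lowH StTrkDQ η f x₀ s hmax R Hs B (j + 1)) / s))
      ≤ 4 * hmax / s + (Hs / s) ^ 2 + B + 1 + ((B : ℝ) + 1) / 2) :=
  Iff.rfl

/-- (K) composition node at `halfPurse`. -/
theorem law421Half_of_succ_rate (hS : RestSuccBotQ) (hR : RestRateBotPQ halfPurse) : Law421P halfPurse :=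
  law421P_of_succ_ratePQ hS hR

end RhW08.PurseP
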